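import Literature.Probability.LatticeModels.KCObservableBulkBounds
import Literature.Probability.LatticeModels.LatticeToContinuumSup
import Literature.Probability.LatticeModels.LatticeToContinuumLip
import HarnessLib

/-!
# Families of spin-fermion data along the mesh: the lattice hypotheses of the continuum chain

Topic `Literature/Probability/LatticeModels`. Chelkak–Hongler–Izyurov 2015, §3.3–3.5: along a family
of discrete domains `Ω_δ` approximating `Ω` with a marked interior point `a`, the spinor observables
`F_δ = F_{[Ω_δ,a]}`, once their primitives `H_δ` are bounded on compacts of `Ω ∖ {a}` (Thm 3.13 /
Lemma 3.10), are `O(ϑ(δ))`-bounded and equicontinuous on compacts (Thm 3.12). This file packages a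
family of Kadanoff–Ceva data along the mesh (`KCFamily`: volume, plaquette set, cuts, primitive per
`δ`) with its standing hypotheses (`KCFamily.IsNice`: admissible cuts and primitive eventually, bulk
geometry and seam-freeness at a positive radius around compacts, and the bound on the primitive —
the latter being the output of CHI's boundary argument, taken here as a hypothesis of the
structure), and DERIVES the lattice hypotheses of the observable-independent continuum chain for
the plain branch of the spin fermion on compacts off the seam ray:

* `KCFamily.obs` (the observable `kcObs` of the data), `seamRay a` (the closed horizontal ray from
  `a` eastwards, the continuum shadow of the lattice seam);
* **`KCFamily.IsNice.latticeSupHyp`**, **`KCFamily.IsNice.latticeLipHyp`**: `LatticeSupHyp` and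
  `LatticeLipHyp` (`LatticeToContinuumSup/Lip.lean`) for `obs` on every compact
  `K ⊆ Ω ∖ seamRay a`, from `norm_kcObs_le_of_bulk` / `norm_sub_kcObs_le_of_bulk`
  (`KCObservableBulkBounds.lean`).

Hence (`exists_sqrt_bound_of_latticeSupHyp`, `exists_equicont_bound_of_hyps`) the `√δ` sup bound and
the `√δ`-equicontinuity of the plain branch on such compacts. Everything is proved; no named fact.

## References

* D. Chelkak, C. Hongler, K. Izyurov, Ann. of Math. 181 (2015): Thm 3.12, §3.5
  [ChelkakHonglerIzyurovAnnals2015].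
-/

noncomputable section

namespace Literature.Probability.LatticeModels

open Filter _root_.Topology Metric Set Finset SimpleGraph

/-- **The seam ray**: the closed horizontal ray from `a` eastwards (plus a unit margin westwards to
cover the source plaquette at every mesh `≤ 1`). [cite: ChelkakHonglerIzyurovAnnals2015, §3.2 (the cut)] -/
def seamRay (a : ℂ) : Set ℂ := {z | z.im = a.im ∧ a.re - 1 ≤ z.re}

/-- The seam ray is closed. [folklore] -/
theorem isClosed_seamRay (a : ℂ) : IsClosed (seamRay a) := by
  have h1 : IsClosed {z : ℂ | z.im = a.im} := isClosed_eq Complex.continuous_im continuous_const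
  have h2 : IsClosed {z : ℂ | a.re - 1 ≤ z.re} := isClosed_le continuous_const Complex.continuous_re
  exact h1.inter h2

/-- `a` lies on its seam ray. [folklore] -/
theorem mem_seamRay_self (a : ℂ) : a ∈ seamRay a := ⟨rfl, by simp⟩

/-- **A family of Kadanoff–Ceva data along the mesh**: free volume, plaquette set, cut system and
primitive pair at every mesh `δ`. [cite: ChelkakHonglerIzyurovAnnals2015, §3.3] -/
structure KCFamily where
  /-- the free sites -/
  Λ : ℝ → Finset (Site 2)
  /-- the plaquettes carrying cuts -/
  P : ℝ → Set (Site 2)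
  /-- the cut system -/
  cut : ℝ → Site 2 → Finset (Sym2 (Site 2))
  /-- the primitive on sites -/
  Hw : ℝ → Site 2 → ℝ
  /-- the primitive on plaquettes -/
  Hb : ℝ → Site 2 → ℝ

namespace KCFamily

variable (𝓕 : KCFamily) (Ω : Set ℂ) (a : ℂ)

/-- The spin fermion of the data at mesh `δ` (`+` boundary condition, no background spins). [cite: ChelkakHonglerIzyurovAnnals2015, Def. 2.1] -/
def obs (δ : ℝ) : MedialVertex → ℂ := kcObs (discreteDomainGraph Ω δ) (𝓕.Λ δ) 1 ∅ (𝓕.cut δ)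

/-- **The standing hypotheses of a nice family** on `Ω` with marked point `a`. [cite: ChelkakHonglerIzyurovAnnals2015, §3.3 and Thm 3.13] -/
structure IsNice : Prop where
  adj : ∀ᶠ δ in 𝓝[>] (0 : ℝ), ∀ v ∈ 𝓕.Λ δ, ∀ k : Fin 4, (discreteDomainGraph Ω δ).Adj v (v + cornerUnit k)
  cuts : ∀ᶠ δ in 𝓝[>] (0 : ℝ), IsKCCuts (discreteDomainGraph Ω δ) (𝓕.Λ δ) (𝓕.cut δ) (𝓕.P δ)
  prim : ∀ᶠ δ in 𝓝[>] (0 : ℝ),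
    IsKCPrimitive (discreteDomainGraph Ω δ) (𝓕.Λ δ) criticalBetaTwo (.fixed 1) ∅ (𝓕.cut δ) (𝓕.Hw δ) (𝓕.Hb δ) (𝓕.P δ)
  bulk : ∀ K ⊆ Ω \ {a}, IsCompact K → ∃ ρ > 0, ∀ᶠ δ in 𝓝[>] (0 : ℝ), ∀ x y : Site 2, meshPoint δ x ∈ K →
    dist (meshPoint δ y) (meshPoint δ x) ≤ ρ →
      y ∈ 𝓕.Λ δ ∧ edgeBoundary (discreteDomainGraph Ω δ) {y} = Finset.univ.image (fun k : Fin 4 => cSrc (y, k)) ∧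
      (∀ k : Fin 4, faceAt y k ∈ 𝓕.P δ) ∧
      (∀ j : Fin 4, s(y + cornerOff j, y + cornerOff j + cornerUnit j) ∈ edgesTouching (discreteDomainGraph Ω δ) (𝓕.Λ δ)) ∧
      Odd #(Finset.univ.filter fun j : Fin 4 => s(y + cornerOff j, y + cornerOff j + cornerUnit j) ∈ 𝓕.cut δ y)
  seam : ∀ K ⊆ Ω \ seamRay a, IsCompact K → ∃ ρ > 0, ∀ᶠ δ in 𝓝[>] (0 : ℝ), ∀ x y : Site 2, meshPoint δ x ∈ K →
    dist (meshPoint δ y) (meshPoint δ x) ≤ ρ →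
      hLowSign ∅ (y + cornerUnit 2) = vLowSign ∅ (𝓕.cut δ) (y + cornerUnit 3) ∧
      vLowSign ∅ (𝓕.cut δ) (y + cornerUnit 3) = hLowSign ∅ y
  hbound : ∀ K ⊆ Ω \ {a}, IsCompact K → ∃ M > 0, ∀ᶠ δ in 𝓝[>] (0 : ℝ), ∀ y : Site 2, meshPoint δ y ∈ K →
    |𝓕.Hw δ y| ≤ M ∧ |𝓕.Hb δ y| ≤ M

variable {𝓕 Ω a}

/-- Sites of a lattice ball about `x` have mesh points within `δ · 2R` of `meshPoint δ x`. [folklore] -/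
theorem dist_meshPoint_le_of_mem_latticeBall {δ : ℝ} (hδ : 0 ≤ δ) {x y : Site 2} {R : ℤ} (hy : y ∈ latticeBall x R) :
    dist (meshPoint δ y) (meshPoint δ x) ≤ δ * (2 * R) :=
  DiscreteDobrushin.dist_meshPoint_le_of_supNear hδ (mem_latticeBall_iff_supNear.1 hy)

/-- **The bulk hypotheses on a lattice ball of Euclidean size `≤ ρ`**, from the clauses of a nice
family at radius `ρ` and the thickened compact. [cite: ChelkakHonglerIzyurovAnnals2015, §3.3] -/
theorem kcBulk_of_clauses {δ : ℝ} (hδ : 0 ≤ δ) {x : Site 2} {R : ℤ} {ρ : ℝ} (hR : δ * (2 * R) ≤ ρ)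
    (hbulk : ∀ y : Site 2, dist (meshPoint δ y) (meshPoint δ x) ≤ ρ →
      y ∈ 𝓕.Λ δ ∧ edgeBoundary (discreteDomainGraph Ω δ) {y} = Finset.univ.image (fun k : Fin 4 => cSrc (y, k)) ∧
      (∀ k : Fin 4, faceAt y k ∈ 𝓕.P δ) ∧
      (∀ j : Fin 4, s(y + cornerOff j, y + cornerOff j + cornerUnit j) ∈ edgesTouching (discreteDomainGraph Ω δ) (𝓕.Λ δ)) ∧
      Odd #(Finset.univ.filter fun j : Fin 4 => s(y + cornerOff j, y + cornerOff j + cornerUnit j) ∈ 𝓕.cut δ y))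
    (hseam : ∀ y : Site 2, dist (meshPoint δ y) (meshPoint δ x) ≤ ρ →
      hLowSign ∅ (y + cornerUnit 2) = vLowSign ∅ (𝓕.cut δ) (y + cornerUnit 3) ∧
      vLowSign ∅ (𝓕.cut δ) (y + cornerUnit 3) = hLowSign ∅ y) :
    KCBulk (discreteDomainGraph Ω δ) (𝓕.Λ δ) ∅ (𝓕.cut δ) (𝓕.P δ) (latticeBall x R) := by
  have hin : ∀ y ∈ latticeBall x R, dist (meshPoint δ y) (meshPoint δ x) ≤ ρ := fun y hy =>
    (dist_meshPoint_le_of_mem_latticeBall hδ hy).trans hR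
  exact ⟨fun y hy => (hbulk y (hin y hy)).1, fun y _ => Finset.notMem_empty y, fun y hy => (hbulk y (hin y hy)).2.1,
    fun y hy => (hbulk y (hin y hy)).2.2.1, fun y hy => (hbulk y (hin y hy)).2.2.2.1, fun y hy => (hbulk y (hin y hy)).2.2.2.2,
    fun y hy => (hseam y (hin y hy)).1, fun y hy => (hseam y (hin y hy)).2⟩

/-- **The lattice sup hypothesis for the plain branch off the seam ray.** [cite: ChelkakHonglerIzyurovAnnals2015, Thm 3.12 (3.12)] -/
theorem IsNice.latticeSupHyp (h : 𝓕.IsNice Ω a) (hΩ : IsOpen Ω) {K : Set ℂ} (hK : IsCompact K) (hKΩ : K ⊆ Ω \ seamRay a) :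
    ∃ ρ > 0, ∃ M > 0, LatticeSupHyp (𝓕.obs Ω) K ρ (kcSupConst M) := by
  -- thicken `K` inside `Ω ∖ seamRay a`
  have hopen : IsOpen (Ω \ seamRay a) := hΩ.sdiff (isClosed_seamRay a)
  obtain ⟨r, hr, hrΩ⟩ := hK.exists_cthickening_subset_open hopen hKΩ
  set K₁ := cthickening r K with hK₁
  have hK₁c : IsCompact K₁ := hK.cthickening
  have hK₁a : K₁ ⊆ Ω \ {a} := fun z hz => ⟨(hrΩ hz).1, fun hza => (hrΩ hz).2 (hza ▸ mem_seamRay_self a)⟩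
  obtain ⟨ρb, hρb, hbulk⟩ := h.bulk K₁ hK₁a hK₁c
  obtain ⟨ρs, hρs, hseam⟩ := h.seam K₁ hrΩ hK₁c
  obtain ⟨M, hM, hbound⟩ := h.hbound K₁ hK₁a hK₁c
  set ρ := min r (min ρb ρs) with hρ
  have hρ0 : 0 < ρ := by positivity
  have hρr : ρ ≤ r := min_le_left _ _
  have hρb' : ρ ≤ ρb := (min_le_right _ _).trans (min_le_left _ _)
  have hρs' : ρ ≤ ρs := (min_le_right _ _).trans (min_le_right _ _)
  refine ⟨ρ / 2, by positivity, M, hM, ?_⟩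
  have h3 : ∀ᶠ δ in 𝓝[>] (0 : ℝ), 0 < δ := self_mem_nhdsWithin
  filter_upwards [h.adj, h.cuts, h.prim, hbulk, hseam, hbound, h3] with δ hadj hcuts hprim hb hs hbd hδ0 x hx p hp hsize y hy i hi
  -- the box of side `16 p` centred at `x`
  set c : Site 2 := ![x 0 - 2 * (4 * p : ℕ), x 1 - 2 * (4 * p : ℕ)] with hcdef
  have hcx : boxCentre c (4 * p) = x := boxCentre_sub x (4 * p)
  have hxK₁ : meshPoint δ x ∈ K₁ := self_subset_cthickening K hx
  -- every site of the big ball is within `ρ` of `meshPoint δ x`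
  have hR : δ * (2 * ((2 * (2 * (4 * (p : ℕ))) + 3 : ℕ) : ℤ)) ≤ ρ := by
    push_cast
    nlinarith [hsize, hδ0.le]
  have hKb := kcBulk_of_clauses (𝓕 := 𝓕) (Ω := Ω) hδ0.le (x := x) (R := ((2 * (2 * (4 * p)) + 3 : ℕ) : ℤ)) hR
    (fun y hy => hb x y hxK₁ (hy.trans hρb')) (fun y hy => hs x y hxK₁ (hy.trans hρs'))
  rw [← hcx] at hKb
  have hMw : ∀ y ∈ latticeBall (boxCentre c (4 * p)) (2 * (2 * (4 * p)) + 1), |𝓕.Hw δ y| ≤ M := by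
    intro y hy
    rw [hcx] at hy
    have hd : dist (meshPoint δ y) (meshPoint δ x) ≤ ρ := by
      refine (dist_meshPoint_le_of_mem_latticeBall hδ0.le hy).trans (le_trans ?_ hR)
      gcongr; push_cast; linarith
    exact (hbd y (Metric.mem_cthickening_of_dist_le _ _ _ _ hx (hd.trans hρr))).1
  have hMb : ∀ y ∈ latticeBall (boxCentre c (4 * p)) (2 * (2 * (4 * p)) + 1), |𝓕.Hb δ y| ≤ M := by
    intro y hy
    rw [hcx] at hy
    have hd : dist (meshPoint δ y) (meshPoint δ x) ≤ ρ := by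
      refine (dist_meshPoint_le_of_mem_latticeBall hδ0.le hy).trans (le_trans ?_ hR)
      gcongr; push_cast; linarith
    exact (hbd y (Metric.mem_cthickening_of_dist_le _ _ _ _ hx (hd.trans hρr))).2
  have hyb : y ∈ latticeBall (boxCentre c (4 * p)) p := by rw [hcx]; exact hy
  have hKb' : KCBulk (discreteDomainGraph Ω δ) (𝓕.Λ δ) ∅ (𝓕.cut δ) (𝓕.P δ)
      (latticeBall (boxCentre c (4 * p)) (2 * (2 * (4 * p)) + 3)) := by
    convert hKb using 2
    push_cast; ring
  exact norm_kcObs_le_of_bulk hprim hcuts hadj (discreteDomainGraph_le_zdGraph Ω δ) hp hKb' hM hMw hMb hyb hi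

/-- **The lattice Lipschitz hypothesis for the plain branch off the seam ray.** [cite: ChelkakHonglerIzyurovAnnals2015, Thm 3.12 (3.13)] -/
theorem IsNice.latticeLipHyp (h : 𝓕.IsNice Ω a) (hΩ : IsOpen Ω) {K : Set ℂ} (hK : IsCompact K) (hKΩ : K ⊆ Ω \ seamRay a) :
    ∃ ρ > 0, ∃ M > 0, LatticeLipHyp (𝓕.obs Ω) K ρ (8 * topGradConst * kcSupConst M) := by
  have hopen : IsOpen (Ω \ seamRay a) := hΩ.sdiff (isClosed_seamRay a)
  obtain ⟨r, hr, hrΩ⟩ := hK.exists_cthickening_subset_open hopen hKΩ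
  set K₁ := cthickening r K with hK₁
  have hK₁c : IsCompact K₁ := hK.cthickening
  have hK₁a : K₁ ⊆ Ω \ {a} := fun z hz => ⟨(hrΩ hz).1, fun hza => (hrΩ hz).2 (hza ▸ mem_seamRay_self a)⟩
  obtain ⟨ρb, hρb, hbulk⟩ := h.bulk K₁ hK₁a hK₁c
  obtain ⟨ρs, hρs, hseam⟩ := h.seam K₁ hrΩ hK₁c
  obtain ⟨M, hM, hbound⟩ := h.hbound K₁ hK₁a hK₁c
  set ρ := min r (min ρb ρs) with hρ
  have hρ0 : 0 < ρ := by positivity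
  have hρr : ρ ≤ r := min_le_left _ _
  have hρb' : ρ ≤ ρb := (min_le_right _ _).trans (min_le_left _ _)
  have hρs' : ρ ≤ ρs := (min_le_right _ _).trans (min_le_right _ _)
  refine ⟨ρ / 2, by positivity, M, hM, ?_⟩
  have h3 : ∀ᶠ δ in 𝓝[>] (0 : ℝ), 0 < δ := self_mem_nhdsWithin
  filter_upwards [h.adj, h.cuts, h.prim, hbulk, hseam, hbound, h3] with δ hadj hcuts hprim hb hs hbd hδ0 x hx q hq hsize y hy j
  set c : Site 2 := ![x 0 - 2 * (4 * (2 * q) : ℕ), x 1 - 2 * (4 * (2 * q) : ℕ)] with hcdef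
  have hcx : boxCentre c (4 * (2 * q)) = x := boxCentre_sub x (4 * (2 * q))
  have hxK₁ : meshPoint δ x ∈ K₁ := self_subset_cthickening K hx
  have hR : δ * (2 * ((2 * (2 * (4 * (2 * q))) + 3 : ℕ) : ℤ)) ≤ ρ := by
    push_cast
    nlinarith [hsize, hδ0.le]
  have hKb := kcBulk_of_clauses (𝓕 := 𝓕) (Ω := Ω) hδ0.le (x := x) (R := ((2 * (2 * (4 * (2 * q))) + 3 : ℕ) : ℤ)) hR
    (fun y hy => hb x y hxK₁ (hy.trans hρb')) (fun y hy => hs x y hxK₁ (hy.trans hρs'))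
  rw [← hcx] at hKb
  have hMw : ∀ y ∈ latticeBall (boxCentre c (4 * (2 * q))) (2 * (2 * (4 * (2 * q))) + 1), |𝓕.Hw δ y| ≤ M := by
    intro y hy
    rw [hcx] at hy
    have hd : dist (meshPoint δ y) (meshPoint δ x) ≤ ρ := by
      refine (dist_meshPoint_le_of_mem_latticeBall hδ0.le hy).trans (le_trans ?_ hR)
      gcongr; push_cast; linarith
    exact (hbd y (Metric.mem_cthickening_of_dist_le _ _ _ _ hx (hd.trans hρr))).1
  have hMb : ∀ y ∈ latticeBall (boxCentre c (4 * (2 * q))) (2 * (2 * (4 * (2 * q))) + 1), |𝓕.Hb δ y| ≤ M := by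
    intro y hy
    rw [hcx] at hy
    have hd : dist (meshPoint δ y) (meshPoint δ x) ≤ ρ := by
      refine (dist_meshPoint_le_of_mem_latticeBall hδ0.le hy).trans (le_trans ?_ hR)
      gcongr; push_cast; linarith
    exact (hbd y (Metric.mem_cthickening_of_dist_le _ _ _ _ hx (hd.trans hρr))).2
  have hyb : y ∈ latticeBall (boxCentre c (4 * (2 * q))) q := by rw [hcx]; exact hy
  have hKb' : KCBulk (discreteDomainGraph Ω δ) (𝓕.Λ δ) ∅ (𝓕.cut δ) (𝓕.P δ)
      (latticeBall (boxCentre c (4 * (2 * q))) (2 * (2 * (4 * (2 * q))) + 3)) := by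
    convert hKb using 2
    push_cast; ring
  have key := norm_sub_kcObs_le_of_bulk hprim hcuts hadj (discreteDomainGraph_le_zdGraph Ω δ) hq hKb' hM hMw hMb hyb (Or.inl rfl) j
  refine key.trans (le_of_eq ?_)
  have h2q0 : (0 : ℝ) < ((2 * q : ℕ) : ℝ) := by positivity
  have hsq : 0 < Real.sqrt ((2 * q : ℕ) : ℝ) := Real.sqrt_pos.2 h2q0
  field_simp


end KCFamily

end Literature.Probability.LatticeModels
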